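import Mathlib.Analysis.SpecialFunctions.Log.Basic
import Literature.IUT.HodgeTheaters.PMBaseKit
import Literature.IUT.HodgeTheaters.LocalFrobenioidsArch
import Literature.IUT.HodgeArakelov.KummerPrimeStrips
import Literature.IUT.HodgeArakelov.GaussianMonoidsGood

/-!
# [IUTchII] §4 interfaces over the [IUTchI] kits: place data, `R_{≥0}(−)` with `log(p_v)`, the archimedean
# constant monoid (bridge)

Merge bridge (abc-iut cell, layer L6 → L5; no re-typing). The [IUTchII] §4 files
`KummerPrimeStrips.lean` (Def 4.9) and `GaussianMonoidsGood.lean` (Props 4.1, 4.3) were typed over three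
small INTERFACE records pending the [IUTchI] side — `PlaceData V` ("the finite set `V ≅ V_mod` with its bad /
good-nonarchimedean / archimedean places", [IUTchI] Def 3.1 (e), (f)), `LogRealDatum` ("`R_{≥0}(−)` with the
distinguished element `log(p_v)`", [IUTchII] Prop 4.1 (ii) p. 121 / Prop 4.3 (ii) p. 127) and
`ConstantMonoidDatum` (units of the constant monoid `Ψ_cns` + `R_{≥0}`, Prop 4.1 (i)/(ii), 4.3 (i)/(ii)). The
[IUTchI]-side kits are now in the tree: `Literature.IUT.HodgeTheaters.PMBaseKit` ([IUTchI] Def 6.1: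
`V`, `𝕍^bad`, `𝕍^arc` as `Finset`s — the abstract place kit the L6 consumers index by) and
`Literature.IUT.HodgeTheaters.ArchLocalFrobenioid` ([IUTchI] Example 3.4: the CAF `𝒜_{D_v}`, `𝒪^▷`,
`log(p_v) := 1`). This file supplies the maps

* `PlaceData.ofFinsets` / `PlaceData.ofPMBaseKit`: a `PMBaseKit` (with `𝕍^bad ≠ ∅`, [IUTchI] Def 3.1 (b)/(f))
  determines the `PlaceData` of [IUTchII] Def 4.9, bad places having priority over `arc` (they are
  nonarchimedean: Def 3.1 (f) "`V^bad_mod ⊆ V_mod` … of nonarchimedean valuations of odd residue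
  characteristic");
* `LogRealDatum.ofResidueChar` (`log(p_v)` for a rational prime `p_v`, positive) and `LogRealDatum.arch`
  (`log(p_v) = 1`, `p_v = e` at archimedean `v`, [IUTchI] §0; = `ArchLocalFrobenioid.logp`);
* `ConstantMonoidDatum.ofArch`: [IUTchII] Prop 4.3 (i)–(ii) p. 127 "`Ψ_cns(U_v) := A^▷`", "`Ψ^ss_cns :=
  Ψ^×_cns × R_{≥0}`" instantiated on the CAF of an `ArchLocalFrobenioid`: units of `𝒪^▷_{𝒜_{D_v}}` and
  `log(p_v) = 1` — so the formal evaluation isomorphism `Ψ_env ⥲ Ψ_gau` of Prop 4.3 (iv)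
  (`ConstantMonoidDatum.evalIso`) applies to the archimedean data of [IUTchI] Example 3.4 as typed.

S. Mochizuki, *Inter-universal Teichmüller theory I*, kurims May-2020 manuscript, Def 3.1 p. 61–62, Ex 3.4
pp. 80–82, Def 6.1 pp. 156–159; *II*, kurims Dec-2020 manuscript, Prop 4.1 pp. 120–122, Prop 4.3
pp. 127–128, Def 4.9 pp. 154–158. Claim key `Mochizuki2012` DISPUTED (D-0012): definitions only; nothing
here asserts a disputed claim.
-/

namespace Literature.IUT.HodgeArakelov

open scoped NNReal
open Literature.IUT.HodgeTheaters

universe u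

/-! ### 1. Place data from the [IUTchI] Def 6.1 kit -/

/-- The type of a place read off the two finite sets `𝕍^bad`, `𝕍^arc ⊆ V` of a `PMBaseKit` ([IUTchI] Def 6.1;
Def 3.1 (e),(f)): bad (priority — bad places are nonarchimedean, Def 3.1 (f)), else archimedean if in
`𝕍^arc`, else good nonarchimedean. [cite: Mochizuki2012, Def 3.1 (f) p.62] -/
def placeKindOfFinsets {V : Type u} [DecidableEq V] (bad arc : Finset V) (v : V) : PlaceKind :=
  if v ∈ bad then PlaceKind.bad else if v ∈ arc then PlaceKind.arch else PlaceKind.goodNonarch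

/-- A place of `𝕍^bad` has type `bad`. [cite: Mochizuki2012, Def 3.1 (f) p.62] -/
theorem placeKindOfFinsets_of_mem_bad {V : Type u} [DecidableEq V] {bad arc : Finset V} {v : V}
    (h : v ∈ bad) : placeKindOfFinsets bad arc v = PlaceKind.bad := by
  simp [placeKindOfFinsets, h]

/-- A place of `𝕍^arc ∖ 𝕍^bad` has type `arch`. [cite: Mochizuki2012, Def 3.1 (e) p.62] -/
theorem placeKindOfFinsets_of_mem_arc {V : Type u} [DecidableEq V] {bad arc : Finset V} {v : V}
    (hb : v ∉ bad) (ha : v ∈ arc) : placeKindOfFinsets bad arc v = PlaceKind.arch := by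
  simp [placeKindOfFinsets, hb, ha]

/-- A place outside `𝕍^bad ∪ 𝕍^arc` has type `goodNonarch` (`V^good ∩ V^non`). [cite: Mochizuki2012, Def 3.1 (e) p.62] -/
theorem placeKindOfFinsets_of_not_mem {V : Type u} [DecidableEq V] {bad arc : Finset V} {v : V}
    (hb : v ∉ bad) (ha : v ∉ arc) : placeKindOfFinsets bad arc v = PlaceKind.goodNonarch := by
  simp [placeKindOfFinsets, hb, ha]

/-- The type is `bad` exactly on `𝕍^bad`. [cite: Mochizuki2012, Def 3.1 (f) p.62] -/
theorem placeKindOfFinsets_eq_bad_iff {V : Type u} [DecidableEq V] {bad arc : Finset V} {v : V} :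
    placeKindOfFinsets bad arc v = PlaceKind.bad ↔ v ∈ bad := by
  unfold placeKindOfFinsets
  by_cases hb : v ∈ bad
  · simp [hb]
  · by_cases ha : v ∈ arc <;> simp [hb, ha]

/-- The `PlaceData` of [IUTchII] Def 4.9 (the prime `l` and the type of each `v ∈ V`) determined by finite
sets `𝕍^bad ≠ ∅` ([IUTchI] Def 3.1 (b) "a nonempty set of nonarchimedean valuations … of odd residue
characteristic") and `𝕍^arc`. [cite: Mochizuki2012, Def 4.9 (vi) p.157] -/
def PlaceData.ofFinsets {V : Type u} [DecidableEq V] (l : ℕ) (bad arc : Finset V) (hbad : bad.Nonempty) :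
    PlaceData V where
  ell := l
  kind := placeKindOfFinsets bad arc
  bad_nonempty := by
    obtain ⟨v, hv⟩ := hbad
    exact ⟨v, placeKindOfFinsets_of_mem_bad hv⟩

/-- The `PlaceData` of [IUTchII] Def 4.9 determined by the place kit `PMBaseKit` of [IUTchI] Def 6.1
(`V`, `𝕍^bad`, `𝕍^arc`; the prime `l` of the kit), given `𝕍^bad ≠ ∅` ([IUTchI] Def 3.1 (b)).
[cite: Mochizuki2012, Def 4.9 (vi) p.157] -/
def PlaceData.ofPMBaseKit {l : ℕ} (K : PMBaseKit.{u} l) (hbad : K.bad.Nonempty) : PlaceData K.V :=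
  letI := K.decEqV
  PlaceData.ofFinsets l K.bad K.arc hbad

/-- The prime recorded is the kit's `l`. [cite: Mochizuki2012, Def 4.9 (vi) p.157] -/
theorem PlaceData.ofPMBaseKit_ell {l : ℕ} (K : PMBaseKit.{u} l) (hbad : K.bad.Nonempty) :
    (PlaceData.ofPMBaseKit K hbad).ell = l := rfl

/-- The bad places of the induced `PlaceData` are exactly `𝕍^bad` of the kit (so the integer `2l`/`1` of
[IUTchII] Def 4.9 (ii)/(iv), `torsionOrder`, is `2l` exactly there). [cite: Mochizuki2012, Def 4.9 (iii) p.155] -/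
theorem PlaceData.ofPMBaseKit_kind_eq_bad_iff {l : ℕ} (K : PMBaseKit.{u} l) (hbad : K.bad.Nonempty)
    (v : K.V) : (PlaceData.ofPMBaseKit K hbad).kind v = PlaceKind.bad ↔ v ∈ K.bad := by
  letI := K.decEqV
  exact placeKindOfFinsets_eq_bad_iff

/-! ### 2. `R_{≥0}(−)` with its distinguished element `log(p_v)` -/

/-- `R_{≥0}(G_v)` with `log(p_v)` for a place of residue characteristic `p_v ≥ 2` ([IUTchII] Prop 4.1 (ii)
p. 121: "the distinguished element … `log^Φ(p_v)`"; positivity from `p_v > 1`). [cite: Mochizuki2012, Prop 4.1 (ii) p.121] -/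
noncomputable def LogRealDatum.ofResidueChar (p : ℕ) (hp : 1 < p) : LogRealDatum where
  logp := ⟨Real.log p, Real.log_nonneg (by exact_mod_cast hp.le)⟩
  logp_pos := by
    change (0 : ℝ) < Real.log p
    exact Real.log_pos (by exact_mod_cast hp)

/-- Its distinguished element is `log(p_v)`. [cite: Mochizuki2012, Prop 4.1 (ii) p.121] -/
theorem LogRealDatum.ofResidueChar_logp (p : ℕ) (hp : 1 < p) :
    ((LogRealDatum.ofResidueChar p hp).logp : ℝ) = Real.log p := rfl

/-- `R_{≥0}(D^⊢_v)` with `log(p_v) = 1` at an archimedean place ([IUTchII] Prop 4.3 (ii) p. 127; `p_v = e`,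
so `log(p_v) = 1`, [IUTchI] §0 / Example 3.4 (iii) "`log(p_v)` … a generator of `Φ_{C^⊢_v}`").
[cite: Mochizuki2012, Prop 4.3 (ii) p.127] -/
def LogRealDatum.arch : LogRealDatum where
  logp := 1
  logp_pos := one_pos

/-- The archimedean `log(p_v)` agrees with `ArchLocalFrobenioid.logp` of [IUTchI] Example 3.4 (iii) (both
are `1 ∈ ℝ≥0`). [cite: Mochizuki2012, Prop 4.3 (ii) p.127] -/
theorem LogRealDatum.arch_logp_eq {Kv : Type u} [NormedField Kv] [NormedAlgebra ℝ Kv]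
    (X : ArchLocalFrobenioid.{u} Kv) : LogRealDatum.arch.logp = X.logp := rfl

/-! ### 3. The archimedean constant monoid of Prop 4.3 from [IUTchI] Example 3.4 -/

/-- **[IUTchII] Prop 4.3 (i)–(ii) p. 127 over [IUTchI] Example 3.4**: "`Ψ_cns(U_v) := A^▷_{U_v}`",
"`Ψ^ss_cns(D^⊢_v) := Ψ_cns(D^⊢_v)^× × R_{≥0}(D^⊢_v)`" — the `ConstantMonoidDatum` whose unit group is the
group of units of `𝒪^▷` of the CAF `𝒜_{D_v}` of an `ArchLocalFrobenioid` (the elements of norm `1`) and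
whose `R_{≥0}` carries `log(p_v) = 1`. [cite: Mochizuki2012, Prop 4.3 (i) p.127] -/
noncomputable def ConstantMonoidDatum.ofArch {Kv : Type u} [NormedField Kv] [NormedAlgebra ℝ Kv]
    (X : ArchLocalFrobenioid.{u} Kv) : ConstantMonoidDatum.{u} where
  Units := CommGrpCat.of (unitDiscMonoid X.Afield)ˣ
  logReal := LogRealDatum.arch

/-- For the archimedean datum the `j`-th weight of the formal evaluation map (Prop 4.3 (iv) p. 128,
"`(…, j²·log^{D^⊢_v}(p_v), …)`") is `c · j²`. [cite: Mochizuki2012, Prop 4.3 (iv) p.128] -/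
theorem ConstantMonoidDatum.ofArch_weight {Kv : Type u} [NormedField Kv] [NormedAlgebra ℝ Kv]
    (X : ArchLocalFrobenioid.{u} Kv) (lstar : ℕ) (c : ℝ≥0) (j : Fin lstar) :
    (ConstantMonoidDatum.ofArch X).weight lstar c j = c * (labelNat j : ℝ≥0) ^ 2 := by
  simp [ConstantMonoidDatum.weight, ConstantMonoidDatum.ofArch, LogRealDatum.arch]

/-- Hence (Prop 4.3 (iv) p. 128) the formal evaluation isomorphism `Ψ_env(U_v) ⥲ Ψ_gau(U_v)` of
`GaussianMonoidsGood` is available for the archimedean data of [IUTchI] Example 3.4 as soon as `l⋇ ≥ 1`.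
[cite: Mochizuki2012, Prop 4.3 (iv) p.128] -/
noncomputable def ConstantMonoidDatum.evalIsoOfArch {Kv : Type u} [NormedField Kv] [NormedAlgebra ℝ Kv]
    (X : ArchLocalFrobenioid.{u} Kv) (lstar : ℕ) (hl : 0 < lstar) :
    (ConstantMonoidDatum.ofArch X).ThetaMonoid ≃* (ConstantMonoidDatum.ofArch X).GaussianMonoid lstar :=
  (ConstantMonoidDatum.ofArch X).evalIso lstar hl

end Literature.IUT.HodgeArakelov
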